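import Summits.ResolutionOfSingularities.ResolutionOfSingularities.Theorems.FrobeniusLadderFRationalResolutionToricResolution
import Summits.ResolutionOfSingularities.ResolutionOfSingularities.Theorems.FrobeniusLadderFRationalResolutionToricVertexUnique
import Summits.ResolutionOfSingularities.ResolutionOfSingularities.Theorems.FrobeniusLadderFRationalResolutionToricLocallyOfFiniteType
import Summits.ResolutionOfSingularities.ResolutionOfSingularities.Theorems.FrobeniusLadderFRationalResolutionFRationalSurfaceLocal
import Summits.ResolutionOfSingularities.ResolutionOfSingularities.Theorems.FrobeniusLadderFRationalResolutionStalkIsoNhd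
import Summits.ResolutionOfSingularities.ResolutionOfSingularities.Theorems.FrobeniusLadderFRationalResolutionRegularLocusOpenImmersion
import Summits.ResolutionOfSingularities.ResolutionOfSingularities.Theorems.FrobeniusLadderFRationalResolutionResolutionRestrict
import HarnessLib

/-!
# F-rational surfaces whose singular STALKS are toric are resolvable; (G2) for toric surface germs

Support file for crux stmt-ResolutionOfSingularities-15317 (`FrobeniusLadder.FRationalResolution`), line `redirect`,
lead c4 (toric surface programme). The tower `stub_toric_offVertex_resolution` (…ToricResolution.lean) resolves every
affine toric surface `U(r,a) = Spec TA[r,a]` by a proper morphism that is an isomorphism over `D(x) ∪ D(w)`, the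
complement of the torus-fixed point (`stub_toric_point_eq`: the vertex is the ONLY point outside `D(x) ∪ D(w)`).
With c3's Zariski-local recognition (`exists_isOpenImmersion_nhd_of_stalk_iso`, p159158) and local-to-global gluing
(`hasResolution_fRational_surface_of_local`, p149439) this gives, generalising the `A_n` showcase (p160375, p161068 —
the Gorenstein diagonal `a = r − 1`) to the whole two-parameter toric family, EVERY FIELD:

* `toric_regularLocus_eq` — if the vertex of `U(r,a)` is singular then `Reg U(r,a) = D(x) ∪ D(w)` exactly
  (regularity over the iso locus of the tower; uniqueness of the vertex);
* `local_resolution_of_toric_stalk` — (G2) FOR TORIC SURFACE GERMS, ON STALKS: a singular point of an integral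
  finite-type `k`-scheme whose local ring is `k`-isomorphic to the vertex local ring of some `U(r,a)` has a
  neighbourhood with a local resolution (iso over the regular locus, dense preimage);
* `hasResolution_fRational_surface_of_toric_stalks` — **an integral F-rational surface all of whose singular
  stalks are toric (k-isomorphic to vertex stalks of affine toric surfaces `U(r,a)`, any `r, a`) has a
  resolution of singularities** — over an algebraically closed field of characteristic `p > 5` this covers all
  F-regular surface germs with cyclic local fundamental group; the statement itself needs no hypothesis on `k`.

All folklore (Kollár 2007 §2.2; Lipman 1978 §2; CLS 2011 §10.1); no published fact is used.
-/

-- single-problem summit: the doubled namespace component is forced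
set_option linter.dupNamespace false

noncomputable section

namespace Summit.ResolutionOfSingularities.ResolutionOfSingularities.Theorems.FRationalResolution

open CategoryTheory AlgebraicGeometry TopologicalSpace
open Literature.AlgebraicGeometry.Resolution

section Toric

variable (k : Type) [Field k]

/-- The Laurent polynomial ring `k[ℤ²]` (coordinate ring of the 2-torus). -/
local notation3 "Lk" => AddMonoidAlgebra k (ℤ × ℤ)

/-- The lattice points of the dual cone `σ∨ = {m₂ ≥ 0, a m₂ ≤ r m₁}` of `σ = cone((0,1),(r,-a))`. -/
local notation3 "σS[" r ", " a "]" =>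
  {m : ℤ × ℤ | 0 ≤ m.2 ∧ ((a : ℕ) : ℤ) * m.2 ≤ ((r : ℕ) : ℤ) * m.1}

/-- The toric surface algebra `k[σ∨ ∩ ℤ²] ⊆ k[ℤ²]`. -/
local notation3 "TA[" r ", " a "]" =>
  Algebra.adjoin k ((fun m : ℤ × ℤ => AddMonoidAlgebra.single m (1 : k)) '' σS[r, a])

/-- **`Reg U(r,a) = D(x) ∪ D(w)` when the vertex is singular.** The open `D(x) ∪ D(w)` is regular because the
tower `stub_toric_offVertex_resolution` is an isomorphism over it from a regular scheme; conversely a regular point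
outside it would contain `x` and `w`, hence be the vertex `q` (`stub_toric_point_eq`), which is singular.
[folklore] -/
theorem toric_regularLocus_eq (r a : ℕ) (har : a < r) (x w : ↥TA[r, a])
    (hx : (x : Lk) = AddMonoidAlgebra.single ((1 : ℤ), (0 : ℤ)) 1)
    (hw : (w : Lk) = AddMonoidAlgebra.single ((a : ℤ), (r : ℤ)) 1)
    (q : Spec (CommRingCat.of ↥TA[r, a])) (hq : x ∈ q.asIdeal ∧ w ∈ q.asIdeal)
    (hqreg : q ∉ Scheme.regularLocus (Spec (CommRingCat.of ↥TA[r, a])))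
    (hReg : IsOpen (Scheme.regularLocus (Spec (CommRingCat.of ↥TA[r, a])))) :
    ((PrimeSpectrum.basicOpen x ⊔ PrimeSpectrum.basicOpen w : (Spec (CommRingCat.of ↥TA[r, a])).Opens)) =
      ⟨Scheme.regularLocus (Spec (CommRingCat.of ↥TA[r, a])), hReg⟩ := by
  have hr : 1 ≤ r := by omega
  apply le_antisymm
  · -- regular over the iso locus of the tower
    obtain ⟨Y, ρ, -, hY, hiso, -⟩ := stub_toric_offVertex_resolution k r a har x w hx hw
    have hUreg := isRegular_opens_of_isIso_morphismRestrict ρ _ hiso hY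
    intro P hP
    show IsRegularLocalRing ((Spec (CommRingCat.of ↥TA[r, a])).presheaf.stalk P)
    haveI := hUreg ⟨P, hP⟩
    exact IsRegularLocalRing.of_ringEquiv
      (asIso ((PrimeSpectrum.basicOpen x ⊔ PrimeSpectrum.basicOpen w :
        (Spec (CommRingCat.of ↥TA[r, a])).Opens).ι.stalkMap ⟨P, hP⟩)).commRingCatIsoToRingEquiv.symm
  · intro P hP
    by_contra hPU
    have hxP : x ∈ P.asIdeal := by
      by_contra h; exact hPU (Or.inl h)
    have hwP : w ∈ P.asIdeal := by
      by_contra h; exact hPU (Or.inr h)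
    have hPq : P = q := stub_toric_point_eq k r a hr x w hx hw P q ⟨hxP, hwP⟩ hq
    exact hqreg (hPq ▸ hP)

/-- **(G2) FOR TORIC SURFACE GERMS, STATED ON STALKS.** Let `X` be an integral `k`-scheme locally of finite type and
`s` a singular point whose local ring is `k`-isomorphic to the local ring of some affine toric surface
`U(r,a) = Spec TA[r,a]` (`a < r`) at its vertex (the point where `x = χ^(1,0)` and `w = χ^(a,r)` vanish),
compatibly with the structure maps. Then `s` has an open neighbourhood `V`, containing no other singular point,
with a LOCAL RESOLUTION: a proper `ρ : Y → V` with `Y` regular, an isomorphism over `V ∩ Reg X` with dense preimage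
(the Hirzebruch–Jung tower of `U(r,a)`, restricted along the Zariski chart produced by recognition).
[folklore; Kollár 2007 §2.2, Lipman 1978 §2, CLS2011 Thm. 10.1.10] -/
theorem local_resolution_of_toric_stalk (X : Scheme.{0}) [IsIntegral X] (f : X ⟶ Spec (.of k))
    [LocallyOfFiniteType f] (s : X) (hs : s ∉ Scheme.regularLocus X) (r a : ℕ) (har : a < r)
    (x w : ↥TA[r, a]) (hx : (x : Lk) = AddMonoidAlgebra.single ((1 : ℤ), (0 : ℤ)) 1)
    (hw : (w : Lk) = AddMonoidAlgebra.single ((a : ℤ), (r : ℤ)) 1)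
    (q : Spec (CommRingCat.of ↥TA[r, a])) (hq : x ∈ q.asIdeal ∧ w ∈ q.asIdeal)
    (e : (Spec (CommRingCat.of ↥TA[r, a])).presheaf.stalk q ≅ X.presheaf.stalk s)
    (he : Spec.map e.hom ≫ (Spec (CommRingCat.of ↥TA[r, a])).fromSpecStalk q ≫
      Spec.map (CommRingCat.ofHom (algebraMap k ↥TA[r, a])) = X.fromSpecStalk s ≫ f) :
    ∃ (V : X.Opens), s ∈ V ∧ (∀ t : X, t ∉ Scheme.regularLocus X → t ∈ V → t = s) ∧
      ∃ (Y : Scheme.{0}) (ρ : Y ⟶ V), IsProper ρ ∧ Scheme.IsRegular Y ∧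
        IsIso (ρ ∣_ (V.ι ⁻¹ᵁ ⟨Scheme.regularLocus X, isOpen_regularLocus_of_locallyOfFiniteType_field f⟩)) ∧
        Dense ((ρ ⁻¹ᵁ (V.ι ⁻¹ᵁ ⟨Scheme.regularLocus X,
          isOpen_regularLocus_of_locallyOfFiniteType_field f⟩) : Y.Opens) : Set Y) := by
  have hr : 1 ≤ r := by omega
  -- `U(r,a)` is an integral `k`-scheme of finite type
  haveI : IsDomain ↥TA[r, a] := inferInstance
  haveI : LocallyOfFiniteType (Spec.map (CommRingCat.ofHom (algebraMap k ↥TA[r, a]))) :=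
    stub_toric_locallyOfFiniteType k r a hr har.le
  -- Zariski-local recognition: a toric chart at `s`
  obtain ⟨U, hsU, j, hj, hjs, -⟩ := exists_isOpenImmersion_nhd_of_stalk_iso k X
    (Spec (CommRingCat.of ↥TA[r, a])) f (Spec.map (CommRingCat.ofHom (algebraMap k ↥TA[r, a]))) s q e he
  haveI := hj
  -- the vertex is singular (its local ring is that of `X` at the singular point `s`)
  have hqreg : q ∉ Scheme.regularLocus (Spec (CommRingCat.of ↥TA[r, a])) := by
    intro hreg
    haveI : IsRegularLocalRing ((Spec (CommRingCat.of ↥TA[r, a])).presheaf.stalk q) := hreg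
    exact hs (show IsRegularLocalRing (X.presheaf.stalk s) from
      IsRegularLocalRing.of_ringEquiv e.commRingCatIsoToRingEquiv)
  -- the regular loci correspond under `j`
  have hReg : IsOpen (Scheme.regularLocus (Spec (CommRingCat.of ↥TA[r, a]))) :=
    isOpen_regularLocus_of_locallyOfFiniteType_field (Spec.map (CommRingCat.ofHom (algebraMap k ↥TA[r, a])))
  have hD := toric_regularLocus_eq k r a har x w hx hw q hq hqreg hReg
  have hpre := preimage_regularLocus_of_isOpenImmersion U j
    (isOpen_regularLocus_of_locallyOfFiniteType_field f) hReg
  have huniq : ∀ t : X, t ∉ Scheme.regularLocus X → t ∈ U → t = s := by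
    intro t ht htU
    have hjt : j ⟨t, htU⟩ ∉ Scheme.regularLocus (Spec (CommRingCat.of ↥TA[r, a])) := by
      intro hreg
      have hmem : (⟨t, htU⟩ : U) ∈ j ⁻¹ᵁ ⟨Scheme.regularLocus (Spec (CommRingCat.of ↥TA[r, a])), hReg⟩ := hreg
      rw [hpre] at hmem
      exact ht hmem
    have hjs' : j ⟨s, hsU⟩ ∉ Scheme.regularLocus (Spec (CommRingCat.of ↥TA[r, a])) := by
      intro hreg
      have hmem : (⟨s, hsU⟩ : U) ∈ j ⁻¹ᵁ ⟨Scheme.regularLocus (Spec (CommRingCat.of ↥TA[r, a])), hReg⟩ := hreg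
      rw [hpre] at hmem
      exact hs hmem
    -- both points lie outside `D(x) ∪ D(w)`, hence are the vertex
    have hout : ∀ P : Spec (CommRingCat.of ↥TA[r, a]), P ∉ Scheme.regularLocus (Spec (CommRingCat.of ↥TA[r, a])) →
        x ∈ P.asIdeal ∧ w ∈ P.asIdeal := by
      intro P hP
      have hPU : P ∉ ((PrimeSpectrum.basicOpen x ⊔ PrimeSpectrum.basicOpen w :
          (Spec (CommRingCat.of ↥TA[r, a])).Opens)) := by rw [hD]; exact hP
      constructor
      · by_contra h; exact hPU (Or.inl h)
      · by_contra h; exact hPU (Or.inr h)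
    have heq : j ⟨t, htU⟩ = j ⟨s, hsU⟩ :=
      stub_toric_point_eq k r a hr x w hx hw _ _ (hout _ hjt) (hout _ hjs')
    have hinj := hj.base_open.injective heq
    exact congrArg Subtype.val hinj
  -- the local resolution: restrict the tower of `U(r,a)` along the chart `j`
  obtain ⟨Y, ρ, hρ, hY, hiso, hd⟩ := stub_offLocus_resolution_restrict _ _ j _
    (stub_toric_offVertex_resolution k r a har x w hx hw)
  rw [hD, hpre] at hiso hd
  exact ⟨U, hsU, huniq, Y, ρ, hρ, hY, hiso, hd⟩

/-- **F-RATIONAL SURFACES WITH TORIC SINGULAR STALKS ARE RESOLVABLE.** Let `X` be an integral `k`-scheme of finite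
type over a field `k` of characteristic `p`, of dimension `≤ 2`, whose stalks satisfy the F-rational clause of
`FRationalResolution`. Suppose that at every singular point `s` the local ring `𝒪_{X,s}` is `k`-isomorphic to the
vertex local ring of some affine toric surface `U(r,a) = Spec k[{m ∈ ℤ² : 0 ≤ m₂, a m₂ ≤ r m₁}]` (`a < r`; any
cyclic quotient surface singularity, any field), compatibly with the structure maps. Then `X` has a resolution of
singularities. [folklore; Kollár 2007 §2.2, Lipman 1978 §2, CLS2011 Thm. 10.1.10] -/
theorem hasResolution_fRational_surface_of_toric_stalks (p : ℕ) (hp : p.Prime) [CharP k p]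
    (X : Scheme.{0}) [IsIntegral X] (f : X ⟶ Spec (.of k)) [LocallyOfFiniteType f] [QuasiCompact f]
    (hFR : ∀ x : X, IsDomain (X.presheaf.stalk x) ∧ ∀ d : ℕ, ringKrullDim (X.presheaf.stalk x) = d →
      ∀ s : Fin d → X.presheaf.stalk x, (Ideal.span (Set.range s)).radical.IsMaximal →
      ∀ y c : X.presheaf.stalk x, c ≠ 0 →
      (∀ e : ℕ, c * y ^ p ^ e ∈ Ideal.span ((fun z : X.presheaf.stalk x => z ^ p ^ e) ''
        (Ideal.span (Set.range s) : Set (X.presheaf.stalk x)))) → y ∈ Ideal.span (Set.range s))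
    (hdim : topologicalKrullDim X ≤ 2)
    (hstalk : ∀ s : X, s ∉ Scheme.regularLocus X → ∃ (r a : ℕ) (_ : a < r) (x w : ↥TA[r, a])
      (_ : (x : Lk) = AddMonoidAlgebra.single ((1 : ℤ), (0 : ℤ)) 1)
      (_ : (w : Lk) = AddMonoidAlgebra.single ((a : ℤ), (r : ℤ)) 1)
      (q : Spec (CommRingCat.of ↥TA[r, a])) (_ : x ∈ q.asIdeal ∧ w ∈ q.asIdeal)
      (e : (Spec (CommRingCat.of ↥TA[r, a])).presheaf.stalk q ≅ X.presheaf.stalk s),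
      Spec.map e.hom ≫ (Spec (CommRingCat.of ↥TA[r, a])).fromSpecStalk q ≫
        Spec.map (CommRingCat.ofHom (algebraMap k ↥TA[r, a])) = X.fromSpecStalk s ≫ f) :
    Scheme.HasResolution X := by
  refine hasResolution_fRational_surface_of_local p hp k X f hFR hdim fun s hs => ?_
  obtain ⟨r, a, har, x, w, hx, hw, q, hq, e, he⟩ := hstalk s hs
  exact local_resolution_of_toric_stalk k X f s hs r a har x w hx hw q hq e he

end Toric

end Summit.ResolutionOfSingularities.ResolutionOfSingularities.Theorems.FRationalResolution

end
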